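import Summits.QuantumFields.YangMills.Theorems.AllWindowsColdBoxBoxHighLineSmearedFPOperator
import Literature.MathematicalPhysics.KineticTheory.HardSphereEulerProofs

/-!
# T-S5.4x «Pauli chart flattening» — the orbit measure `⊗_{x ∈ I} σ(A_x)dA_x` on `I → ℝ³` as a density against flat Lebesgue
# measure on `I × Fin 3 → ℝ` through w2's `vecToField`

Untabled glue brick of step (1b)/(1c) (planner ym-idea-2 g17, `STUB-PLAN-S5U5-STEP1c.md` §1, the dictionary line «`ι := ↥(interiorSites H) × Fin 3`,
`v := A` flattened (w2's `vecToField`)») for the XL comparison stubs S5 (LINE-19 ⟨stmt-QuantumFields-24004⟩/⟨24335⟩) and U5 (LINE-20 ⟨24336⟩).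
After ✓T-S5.4b `orbitAveragePauli` (w3) the orbit normaliser is an integral against `Measure.pi (fun _ : ↥(interiorSites H) => sigmaMeasure)` on
`↥(interiorSites H) → EuclideanSpace ℝ (Fin 3)`, while the Gaussian bricks (✓4a, 4k, ✓4w `GaussianChartWick`, w2's `fpOperator`) live on flat Lebesgue
measure on `↥(interiorSites H) × Fin 3 → ℝ`.  This file is the measure-theoretic bridge:

* `measurePreserving_curry` — currying `(ι × κ → ℝ) ≃ᵐ (ι → κ → ℝ)` preserves Lebesgue measure (any finite `ι`, `κ`; `Measure.pi_eq_generateFrom`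
  on boxes of boxes);
* `measurePreserving_vecToField` — w2's `vecToField H : (↥I × Fin 3 → ℝ) → (↥I → EuclideanSpace ℝ (Fin 3))` preserves Lebesgue measure
  (currying + Mathlib's `PiLp.volume_preserving_toLp` coordinatewise), and `exists_measurableEquiv_vecToField` (it is a measurable equivalence, so
  integrals transfer for EVERY integrand: `integral_comp_vecToField`);
* `sigmaMeasure_eq_withDensity_indicator`, **`pi_sigmaMeasure_eq_withDensity`** — `⊗_x σ = (⊗_x d³A_x).withDensity (∏_x 1_{|A_x|<π} σ_{SU(2)}(|A_x|))`
  (the tree's ✓`KineticTheory.pi_withDensity_eq`);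
* **`integral_pi_sigmaMeasure_eq_integral_flat`** — for every `G`,
  `∫ G d(⊗_x σ) = ∫_{↥I × Fin 3 → ℝ} (∏_x 1_{|A_x|<π} σ_{SU(2)}(|A_x|)) · G(A) dv`, `A = vecToField H v`.

Tree (✓…SmearedFPOperator, ✓B10Eq18SigmaSU2Haar, ✓KineticTheory.HardSphereEulerProofs for `pi_withDensity_eq`) + Mathlib; no definitions.
HONEST LABEL: glue of step (1b)/(1c); T-S5.4 proper, S5, U5, ⟨24004⟩ ⟨24335⟩ ⟨24336⟩ remain OPEN; no summit is proved; the Yang–Mills mass gap is NOT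
proved by this file.  Seat ym-line-sfw-p2 g77 (LEAD, cell ym-idea-1).
-/

set_option autoImplicit false

noncomputable section

open MeasureTheory Set Finset
open scoped ENNReal
open Literature.MathematicalPhysics.QuantumFieldTheory.Balaban1983to89.B10Eq18SigmaSU2Haar (sigmaMeasure isProbabilityMeasure_sigmaMeasure)
open Literature.MathematicalPhysics.QuantumFieldTheory.Balaban1983to89.B10Eq22Rescaling (sigmaSU2)

namespace Summit.QuantumFields.YangMills.Theorems.AllWindowsColdBoxBoxHighLine

namespace PauliChartFlattening

/-! ## Currying preserves Lebesgue measure -/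

/-- **Currying preserves Lebesgue measure**: `(ι × κ → ℝ) ≃ᵐ (ι → κ → ℝ)` maps `volume` to `volume` (finite `ι`, `κ`). -/
theorem measurePreserving_curry (ι κ : Type*) [Fintype ι] [Fintype κ] :
    MeasurePreserving (MeasurableEquiv.curry ι κ ℝ) (volume : Measure (ι × κ → ℝ)) (volume : Measure (ι → κ → ℝ)) := by
  classical
  refine ⟨(MeasurableEquiv.curry ι κ ℝ).measurable, ?_⟩
  rw [show (volume : Measure (ι → κ → ℝ)) = Measure.pi fun _ : ι => (volume : Measure (κ → ℝ)) from volume_pi]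
  symm
  refine Measure.pi_eq_generateFrom (C := fun _ : ι => Set.pi univ '' Set.pi univ fun _ : κ => {t : Set ℝ | MeasurableSet t})
    (fun _ => generateFrom_pi) (fun _ => isPiSystem_pi) (fun _ => ?_) fun s hs => ?_
  · rw [show (volume : Measure (κ → ℝ)) = Measure.pi fun _ : κ => (volume : Measure ℝ) from volume_pi]
    exact Measure.FiniteSpanningSetsIn.pi fun _ => (volume : Measure ℝ).toFiniteSpanningSetsIn
  · -- each `s i` is a box `pi univ (t i)` with measurable sides
    choose t ht hts using fun i => (Set.mem_image _ _ _).1 (hs i)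
    have htm : ∀ i k, MeasurableSet (t i k) := fun i k => by
      have := ht i; rw [Set.mem_univ_pi] at this; exact this k
    have hsm : ∀ i, MeasurableSet (s i) := fun i => by rw [← hts i]; exact MeasurableSet.univ_pi (htm i)
    rw [Measure.map_apply (MeasurableEquiv.curry ι κ ℝ).measurable (MeasurableSet.univ_pi hsm)]
    have hpre : (MeasurableEquiv.curry ι κ ℝ) ⁻¹' Set.pi univ s = Set.pi univ fun p : ι × κ => t p.1 p.2 := by
      ext v
      simp only [Set.mem_preimage, Set.mem_univ_pi, Prod.forall]
      refine ⟨fun h i k => ?_, fun h i => ?_⟩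
      · have hi := h i
        rw [← hts i, Set.mem_univ_pi] at hi
        exact hi k
      · rw [← hts i, Set.mem_univ_pi]
        exact fun k => h i k
    rw [hpre, volume_pi_pi, Fintype.prod_prod_type]
    refine Finset.prod_congr rfl fun i _ => ?_
    rw [← hts i, volume_pi_pi]

/-! ## `vecToField` preserves Lebesgue measure -/

/-- `vecToField H` is (coordinatewise `toLp`) ∘ (currying). -/
theorem vecToField_eq_comp (H : ℕ) :
    vecToField H = (fun (a : ↥(interiorSites H) → Fin 3 → ℝ) (y : ↥(interiorSites H)) => WithLp.toLp 2 (a y)) ∘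
      (MeasurableEquiv.curry (↥(interiorSites H)) (Fin 3) ℝ) := by
  funext v y
  rfl

/-- **`vecToField H` preserves Lebesgue measure** (`volume` on `↥I × Fin 3 → ℝ` ↦ `volume = ⊗_x d³A_x` on `↥I → EuclideanSpace ℝ (Fin 3)`). -/
theorem measurePreserving_vecToField (H : ℕ) :
    MeasurePreserving (vecToField H) (volume : Measure (↥(interiorSites H) × Fin 3 → ℝ))
      (volume : Measure (↥(interiorSites H) → EuclideanSpace ℝ (Fin 3))) := by
  rw [vecToField_eq_comp]
  exact (volume_preserving_pi fun _ : ↥(interiorSites H) => PiLp.volume_preserving_toLp (Fin 3)).comp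
    (measurePreserving_curry _ _)

/-- `vecToField H` is a measurable equivalence (currying, then `toLp` in each coordinate). -/
theorem exists_measurableEquiv_vecToField (H : ℕ) :
    ∃ e : (↥(interiorSites H) × Fin 3 → ℝ) ≃ᵐ (↥(interiorSites H) → EuclideanSpace ℝ (Fin 3)), ⇑e = vecToField H :=
  ⟨(MeasurableEquiv.curry (↥(interiorSites H)) (Fin 3) ℝ).trans
      (MeasurableEquiv.piCongrRight fun _ => MeasurableEquiv.toLp 2 (Fin 3 → ℝ)),
    by funext v y; rfl⟩

/-- **Change of variables through `vecToField`** (every integrand): `∫ g(A) d(⊗_x d³A_x) = ∫ g(vecToField H v) dv`. -/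
theorem integral_comp_vecToField (H : ℕ) (g : (↥(interiorSites H) → EuclideanSpace ℝ (Fin 3)) → ℝ) :
    ∫ v : ↥(interiorSites H) × Fin 3 → ℝ, g (vecToField H v) = ∫ A : ↥(interiorSites H) → EuclideanSpace ℝ (Fin 3), g A := by
  obtain ⟨e, he⟩ := exists_measurableEquiv_vecToField H
  have hmp : MeasurePreserving e (volume : Measure (↥(interiorSites H) × Fin 3 → ℝ))
      (volume : Measure (↥(interiorSites H) → EuclideanSpace ℝ (Fin 3))) := by
    rw [show (e : (↥(interiorSites H) × Fin 3 → ℝ) → (↥(interiorSites H) → EuclideanSpace ℝ (Fin 3))) = vecToField H from he]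
    exact measurePreserving_vecToField H
  rw [← he]
  exact hmp.integral_comp' g

/-! ## `⊗_x σ(A_x)dA_x` as a density against `⊗_x d³A_x` -/

/-- `σ(A)dA = d³A.withDensity(1_{|A|<π} σ_{SU(2)}(|A|))`. -/
theorem sigmaMeasure_eq_withDensity_indicator :
    sigmaMeasure = (volume : Measure (EuclideanSpace ℝ (Fin 3))).withDensity
      ((Metric.ball (0 : EuclideanSpace ℝ (Fin 3)) Real.pi).indicator fun A => ENNReal.ofReal (sigmaSU2 ‖A‖)) := by
  rw [sigmaMeasure, withDensity_indicator Metric.isOpen_ball.measurableSet]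

/-- The product density `∏_x 1_{|A_x|<π} σ_{SU(2)}(|A_x|)` (as `ℝ≥0∞`). -/
theorem measurable_prod_indicator_sigma (H : ℕ) :
    Measurable fun A : ↥(interiorSites H) → EuclideanSpace ℝ (Fin 3) =>
      ∏ x, (Metric.ball (0 : EuclideanSpace ℝ (Fin 3)) Real.pi).indicator (fun a => ENNReal.ofReal (sigmaSU2 ‖a‖)) (A x) := by
  refine Finset.measurable_prod _ fun x _ => ?_
  exact ((Literature.MathematicalPhysics.QuantumFieldTheory.Balaban1983to89.B10Eq18SigmaSU2Haar.measurable_sigmaSU2_norm.ennreal_ofReal).indicator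
    Metric.isOpen_ball.measurableSet).comp (measurable_pi_apply x)

/-- **`⊗_x σ(A_x)dA_x = (⊗_x d³A_x).withDensity (∏_x 1_{|A_x|<π} σ_{SU(2)}(|A_x|))`**. -/
theorem pi_sigmaMeasure_eq_withDensity (H : ℕ) :
    Measure.pi (fun _ : ↥(interiorSites H) => sigmaMeasure) =
      (volume : Measure (↥(interiorSites H) → EuclideanSpace ℝ (Fin 3))).withDensity fun A =>
        ∏ x, (Metric.ball (0 : EuclideanSpace ℝ (Fin 3)) Real.pi).indicator (fun a => ENNReal.ofReal (sigmaSU2 ‖a‖)) (A x) := by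
  have hσ : ∀ _x : ↥(interiorSites H), SigmaFinite ((volume : Measure (EuclideanSpace ℝ (Fin 3))).withDensity
      ((Metric.ball (0 : EuclideanSpace ℝ (Fin 3)) Real.pi).indicator fun A => ENNReal.ofReal (sigmaSU2 ‖A‖))) := fun _ => by
    rw [← sigmaMeasure_eq_withDensity_indicator]
    haveI := isProbabilityMeasure_sigmaMeasure
    infer_instance
  rw [sigmaMeasure_eq_withDensity_indicator, volume_pi]
  exact Literature.MathematicalPhysics.KineticTheory.pi_withDensity_eq (fun _ => volume)
    (fun _ => (Literature.MathematicalPhysics.QuantumFieldTheory.Balaban1983to89.B10Eq18SigmaSU2Haar.measurable_sigmaSU2_norm.ennreal_ofReal).indicator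
      Metric.isOpen_ball.measurableSet) hσ

/-- The real product density: `(∏_x 1_{ball} ofReal σ)ₜₒReal = ∏_x 1_{ball} σ`. -/
theorem toReal_prod_indicator_sigma (H : ℕ) (A : ↥(interiorSites H) → EuclideanSpace ℝ (Fin 3)) :
    (∏ x, (Metric.ball (0 : EuclideanSpace ℝ (Fin 3)) Real.pi).indicator (fun a => ENNReal.ofReal (sigmaSU2 ‖a‖)) (A x)).toReal =
      ∏ x, (Metric.ball (0 : EuclideanSpace ℝ (Fin 3)) Real.pi).indicator (fun a => sigmaSU2 ‖a‖) (A x) := by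
  rw [ENNReal.toReal_prod]
  refine Finset.prod_congr rfl fun x _ => ?_
  by_cases hx : A x ∈ Metric.ball (0 : EuclideanSpace ℝ (Fin 3)) Real.pi
  · rw [Set.indicator_of_mem hx, Set.indicator_of_mem hx, ENNReal.toReal_ofReal]
    have hπ : ‖A x‖ < Real.pi := by simpa using hx
    exact (Literature.MathematicalPhysics.QuantumFieldTheory.Balaban1983to89.B10Eq22Rescaling.sigmaSU2_pos (norm_nonneg _) hπ).le
  · rw [Set.indicator_of_notMem hx, Set.indicator_of_notMem hx, ENNReal.toReal_zero]

end PauliChartFlattening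

open PauliChartFlattening

/-- **THE ORBIT MEASURE IN THE FLAT CHART** (every integrand `G`): with `A = vecToField H v`,
`∫ G d(⊗_{x∈I} σ(A_x)dA_x) = ∫_{↥I × Fin 3 → ℝ} (∏_x 1_{|A_x|<π} σ_{SU(2)}(|A_x|)) · G(A) dv`. -/
theorem integral_pi_sigmaMeasure_eq_integral_flat (H : ℕ) (G : (↥(interiorSites H) → EuclideanSpace ℝ (Fin 3)) → ℝ) :
    ∫ A, G A ∂(Measure.pi fun _ : ↥(interiorSites H) => sigmaMeasure) =
      ∫ v : ↥(interiorSites H) × Fin 3 → ℝ,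
        (∏ x, (Metric.ball (0 : EuclideanSpace ℝ (Fin 3)) Real.pi).indicator (fun a => sigmaSU2 ‖a‖) (vecToField H v x)) *
          G (vecToField H v) := by
  rw [pi_sigmaMeasure_eq_withDensity,
    integral_withDensity_eq_integral_toReal_smul (measurable_prod_indicator_sigma H)
      (Filter.Eventually.of_forall fun A => ENNReal.prod_lt_top fun x _ => by
        by_cases hx : A x ∈ Metric.ball (0 : EuclideanSpace ℝ (Fin 3)) Real.pi
        · rw [Set.indicator_of_mem hx]; exact ENNReal.ofReal_lt_top
        · rw [Set.indicator_of_notMem hx]; exact ENNReal.zero_lt_top),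
    ← integral_comp_vecToField H]
  refine integral_congr_ae (Filter.Eventually.of_forall fun v => ?_)
  simp only [toReal_prod_indicator_sigma, smul_eq_mul]

end Summit.QuantumFields.YangMills.Theorems.AllWindowsColdBoxBoxHighLine

end
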